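import Mathlib.MeasureTheory.Integral.RieszMarkovKakutani.Real
import Mathlib.MeasureTheory.Group.Integral
import Mathlib.MeasureTheory.Measure.Haar.Unique
import Mathlib.MeasureTheory.Integral.Bochner.Set
import Mathlib.Topology.Algebra.ProperAction.Basic
import Mathlib.Topology.UrysohnsLemma
import HarnessLib

/-!
# Averaging over a closed subgroup: `C_c(G) → C_c(G ⧸ H)` and the lifting lemma
(Weil 1940, §9; Loomis, *An Introduction to Abstract Harmonic Analysis* (1953), §33A–§33B)

Let `G` be a locally compact group and `H ≤ G` a closed subgroup with a Haar measure `dh` (for the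
Borel structure on `H` supplied by the caller).  For `f ∈ C_c(G)` the AVERAGE
`f♭(x) = ∫_H f(x h) dh` is right `H`-invariant, continuous and descends to a continuous compactly
supported function on the space `G ⧸ H` of left cosets (`averageQuot`, `averageCc`); and the map
`f ↦ f♭` is ONTO `C_c(G ⧸ H)`, with non-negative lifts of non-negative functions (`exists_lift`,
Loomis §33B: `f = (Φ ∘ mk) · u / max(u♭, c)` for a cut-off `u ∈ C_c(G)` positive on a compact set
`A` with `mk(A) ⊇ tsupport Φ` — compact subsets of `G ⧸ H` lift, `exists_isCompact_image_mk_superset`).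
This is the function-theoretic half of Weil's construction of invariant quotient measures
(file `InvariantQuotientMeasure`).

## Mathlib search

Mathlib has Haar measures, `G ⧸ H` for any subgroup with its quotient topology
(`QuotientGroup.isOpenQuotientMap_mk`, `QuotientGroup.instLocallyCompactSpace`,
`QuotientGroup.instT2Space` for closed `H`), `continuous_parametric_integral_of_continuous`,
Urysohn for locally compact spaces (`exists_continuous_one_zero_of_isCompact`) — all used — but no
averaging map `C_c(G) → C_c(G ⧸ H)` and no quotient (Weil) measures for non-discrete subgroups
(`Mathlib.MeasureTheory.Measure.Haar.Quotient` treats countable `Γ` with a fundamental domain).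
Nothing is re-declared.

## Design

`H`'s measurable structure is an instance argument (the consumer supplies the Borel one), the Haar
measure on `H` is `Measure.haar` (`haarSub`); all statements are about the concrete `average hH f`.
Continuity of `f♭` is proved locally: on a compact neighbourhood `C` of `x₀` the integral runs over
the fixed compact window `{h | h ∈ C⁻¹ tsupport f}` (`isCompact_window`).

## Deliberately NOT here

The integral identity `∫ f φ♭ = ∫ φ f♭`, the functional and the measure (file
`InvariantQuotientMeasure`); modular functions / the non-unimodular case; `L¹` versions.
-/

noncomputable section

open MeasureTheory Measure Set Filter Topology Function CompactlySupported
open scoped Pointwise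

namespace Literature.MeasureTheory.Group

namespace WeilQuotient

variable {G : Type*} [Group G] [TopologicalSpace G] [IsTopologicalGroup G] [LocallyCompactSpace G]
  {H : Subgroup G} [MeasurableSpace ↥H] [BorelSpace ↥H] (hH : IsClosed (H : Set G))

/-! ### Haar measure on the closed subgroup (for the Borel structure supplied by the caller) -/

/-- A Haar measure on the closed (hence locally compact) subgroup `H`. [folklore] -/
def haarSub : Measure ↥H :=
  haveI : LocallyCompactSpace ↥H := hH.locallyCompactSpace
  Measure.haar

/-- `haarSub` is a Haar measure. [folklore] -/
instance isHaarMeasure_haarSub : (haarSub hH).IsHaarMeasure := by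
  haveI : LocallyCompactSpace ↥H := hH.locallyCompactSpace
  unfold haarSub
  infer_instance

/-! ### The averaging map `f ↦ (x ↦ ∫_H f(xh) dh)` -/

/-- The **average** `f♭(x) = ∫_H f(x h) dh` of `f : G → ℝ` over the cosets `xH`. [folklore] -/
def average (f : G → ℝ) (x : G) : ℝ :=
  ∫ h : ↥H, f (x * h) ∂haarSub hH

/-- The average is right `H`-invariant: `f♭(x h₀) = f♭(x)`. [folklore] -/
theorem average_mul_coe (f : G → ℝ) (x : G) (h₀ : ↥H) :
    average hH f (x * h₀) = average hH f x := by
  unfold average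
  have : (fun h : ↥H => f (x * h₀ * h)) = fun h => (fun h' : ↥H => f (x * h')) (h₀ * h) := by
    funext h; simp [mul_assoc]
  rw [this]
  exact integral_mul_left_eq_self (fun h' : ↥H => f (x * h')) h₀

/-- Compatibility with the left coset relation: `x⁻¹ y ∈ H → f♭(x) = f♭(y)`. [folklore] -/
theorem average_eq_of_leftRel (f : G → ℝ) {x y : G} (hxy : x⁻¹ * y ∈ H) :
    average hH f x = average hH f y := by
  have : y = x * (⟨x⁻¹ * y, hxy⟩ : ↥H) := by simp
  rw [this, average_mul_coe]

/-- Left translations commute with averaging: `(f(g₀ ·))♭(x) = f♭(g₀ x)`. [folklore] -/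
theorem average_comp_mul_left (f : G → ℝ) (g₀ x : G) :
    average hH (fun y => f (g₀ * y)) x = average hH f (g₀ * x) := by
  unfold average
  simp only [mul_assoc]

/-- Averaging is homogeneous. [folklore] -/
theorem average_smul (c : ℝ) (f : G → ℝ) (x : G) :
    average hH (c • f) x = c * average hH f x := by
  unfold average
  simp only [Pi.smul_apply, smul_eq_mul, integral_const_mul]

/-- Averaging a product with a right `H`-invariant factor: `(f · (c♭-like))♭ = c · f♭` when
`c(x h) = c(x)`; used with `c = Φ ∘ mk / max(U, c₀)`. [folklore] -/
theorem average_mul_of_invariant (f c : G → ℝ) (hc : ∀ (x : G) (h : ↥H), c (x * h) = c x) (x : G) :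
    average hH (fun y => c y * f y) x = c x * average hH f x := by
  unfold average
  have : (fun h : ↥H => c (x * h) * f (x * h)) = fun h : ↥H => c x * f (x * h) := by
    funext h; rw [hc]
  rw [this, integral_const_mul]

/-- The average of a non-negative function is non-negative. [folklore] -/
theorem average_nonneg {f : G → ℝ} (hf : ∀ x, 0 ≤ f x) (x : G) : 0 ≤ average hH f x :=
  integral_nonneg fun _ => hf _

omit [LocallyCompactSpace G] [MeasurableSpace ↥H] [BorelSpace ↥H] in
include hH in
/-- The elements of `H` that can move a point of the compact `C` into the compact `K` form a
compact subset of `H` (preimage of `C⁻¹ K` under the closed embedding `H ↪ G`). [folklore] -/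
theorem isCompact_window {C K : Set G} (hC : IsCompact C) (hK : IsCompact K) :
    IsCompact {h : ↥H | (h : G) ∈ C⁻¹ * K} :=
  hH.isClosedEmbedding_subtypeVal.isCompact_preimage (hC.inv.mul hK)

omit [IsTopologicalGroup G] [LocallyCompactSpace G] [MeasurableSpace ↥H] [BorelSpace ↥H] in
/-- Outside the window the integrand vanishes: `x ∈ C`, `f` supported in `K`, `h ∉ C⁻¹ K ⇒ f(xh) = 0`.
[folklore] -/
theorem apply_mul_eq_zero_of_not_mem_window {f : G → ℝ} {C K : Set G} (hK : tsupport f ⊆ K)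
    {x : G} (hx : x ∈ C) {h : ↥H} (hh : (h : G) ∉ C⁻¹ * K) : f (x * h) = 0 := by
  by_contra hne
  exact hh ⟨x⁻¹, Set.inv_mem_inv.2 hx, x * h, hK (subset_tsupport _ hne), by simp⟩

/-- **The average of a continuous compactly supported function is continuous.**  Near `x₀` (on a
compact neighbourhood `C`) the integral is over the fixed compact window `{h | h ∈ C⁻¹ tsupport f}`,
where Mathlib's `continuous_parametric_integral_of_continuous` applies. [folklore] -/
theorem continuous_average [SecondCountableTopology G] {f : G → ℝ} (hf : Continuous f)
    (hfs : HasCompactSupport f) : Continuous (average hH f) := by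
  haveI : LocallyCompactSpace ↥H := hH.locallyCompactSpace
  haveI : SecondCountableTopology ↥H := TopologicalSpace.Subtype.secondCountableTopology (H : Set G)
  rw [continuous_iff_continuousAt]
  intro x₀
  obtain ⟨C, hCc, hCx⟩ := exists_compact_mem_nhds x₀
  set D : Set ↥H := {h : ↥H | (h : G) ∈ C⁻¹ * tsupport f} with hD
  have hDc : IsCompact D := isCompact_window hH hCc hfs
  -- on `C` the average is the integral over the window `D`
  have hEq : ∀ x ∈ C, average hH f x = ∫ h in D, f (x * h) ∂haarSub hH := by
    intro x hx
    unfold average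
    rw [setIntegral_eq_integral_of_forall_compl_eq_zero]
    intro h hh
    exact apply_mul_eq_zero_of_not_mem_window (subset_refl _) hx hh
  have hcont : Continuous fun x : G => ∫ h in D, f (x * h) ∂haarSub hH := by
    have hc : Continuous (fun p : G × ↥H => f (p.1 * p.2)) :=
      hf.comp (continuous_fst.mul (continuous_subtype_val.comp continuous_snd))
    exact continuous_parametric_integral_of_continuous (μ := haarSub hH)
      (f := fun (x : G) (h : ↥H) => f (x * h)) hc hDc
  refine (hcont.continuousAt (x := x₀)).congr ?_
  exact Filter.eventuallyEq_of_mem hCx fun x hx => (hEq x hx).symm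

/-- If the average does not vanish at `x` then `xH` meets the support of `f`. [folklore] -/
theorem exists_mem_tsupport_of_average_ne_zero {f : G → ℝ} {x : G} (hx : average hH f x ≠ 0) :
    ∃ h : ↥H, x * h ∈ tsupport f := by
  by_contra hne
  push Not at hne
  apply hx
  unfold average
  refine integral_eq_zero_of_ae (Eventually.of_forall fun h => ?_)
  show f (x * h) = 0
  by_contra h0
  exact hne h (subset_tsupport _ h0)

/-- A non-vanishing average has a non-vanishing integrand somewhere on the coset. [folklore] -/
theorem exists_apply_mul_ne_zero_of_average_ne_zero {f : G → ℝ} {x : G}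
    (hx : average hH f x ≠ 0) : ∃ h : ↥H, f (x * h) ≠ 0 := by
  by_contra hne
  push Not at hne
  apply hx
  unfold average
  exact integral_eq_zero_of_ae (Eventually.of_forall fun h => hne h)

/-- `h ↦ k(x h)` is integrable on `H` for `k ∈ C_c(G)` (supported in the compact window of `{x}`).
[folklore] -/
theorem integrable_comp_mul [T2Space G] {k : G → ℝ} (hk : Continuous k) (hks : HasCompactSupport k)
    (x : G) : Integrable (fun h : ↥H => k (x * h)) (haarSub hH) := by
  haveI : LocallyCompactSpace ↥H := hH.locallyCompactSpace
  refine Continuous.integrable_of_hasCompactSupport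
    (hk.comp (continuous_const.mul continuous_subtype_val)) ?_
  have hDc : IsCompact {h : ↥H | (h : G) ∈ ({x} : Set G)⁻¹ * tsupport k} :=
    isCompact_window hH isCompact_singleton hks
  refine HasCompactSupport.intro' hDc ?_ ?_
  · exact ((isCompact_singleton (x := x)).inv.mul hks).isClosed.preimage continuous_subtype_val
  · intro h hh
    exact apply_mul_eq_zero_of_not_mem_window (subset_refl _) (mem_singleton x) hh

/-- Additivity of averaging on continuous compactly supported functions. [folklore] -/
theorem average_add [T2Space G] {f g : G → ℝ} (hf : Continuous f) (hfs : HasCompactSupport f)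
    (hg : Continuous g) (hgs : HasCompactSupport g) (x : G) :
    average hH (f + g) x = average hH f x + average hH g x := by
  unfold average
  simp only [Pi.add_apply]
  exact integral_add (integrable_comp_mul hH hf hfs x) (integrable_comp_mul hH hg hgs x)

/-! ### Descent to the coset space `G ⧸ H` -/

/-- The **averaged function on `G ⧸ H`**: `f♭(xH) = ∫_H f(xh) dh`. [folklore] -/
def averageQuot (f : G → ℝ) : G ⧸ H → ℝ :=
  Quotient.lift (average hH f) fun _ _ hxy => average_eq_of_leftRel hH f (QuotientGroup.leftRel_apply.1 hxy)

/-- `f♭(mk x) = ∫_H f(xh) dh` (definitional). [folklore] -/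
@[simp] theorem averageQuot_mk (f : G → ℝ) (x : G) :
    averageQuot hH f (x : G ⧸ H) = average hH f x := rfl

/-- `f♭` is continuous on `G ⧸ H` (quotient map). [folklore] -/
theorem continuous_averageQuot [SecondCountableTopology G] {f : G → ℝ} (hf : Continuous f)
    (hfs : HasCompactSupport f) : Continuous (averageQuot hH f) := by
  rw [(QuotientGroup.isQuotientMap_mk H).continuous_iff]
  exact continuous_average hH hf hfs

/-- `f♭` is compactly supported: its support lies in the image of `tsupport f`. [folklore] -/
theorem hasCompactSupport_averageQuot [T2Space G] [IsClosed (H : Set G)] {f : G → ℝ}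
    (hfs : HasCompactSupport f) : HasCompactSupport (averageQuot hH f) := by
  refine HasCompactSupport.intro (hfs.image QuotientGroup.continuous_mk) ?_
  intro q hq
  induction q using QuotientGroup.induction_on with
  | H x =>
    rw [averageQuot_mk]
    by_contra hne
    obtain ⟨h, hh⟩ := exists_mem_tsupport_of_average_ne_zero hH hne
    exact hq ⟨x * h, hh, by
      rw [QuotientGroup.eq]
      simp⟩

/-- `f ↦ f♭` as a map `C_c(G) → C_c(G ⧸ H)`. [folklore] -/
def averageCc [T2Space G] [SecondCountableTopology G] [IsClosed (H : Set G)] (f : C_c(G, ℝ)) :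
    C_c(G ⧸ H, ℝ) where
  toFun := averageQuot hH f
  continuous_toFun := continuous_averageQuot hH f.continuous f.hasCompactSupport
  hasCompactSupport' := hasCompactSupport_averageQuot hH f.hasCompactSupport

/-- `averageCc f (mk x) = ∫_H f(xh) dh` (definitional). [folklore] -/
@[simp] theorem averageCc_mk [T2Space G] [SecondCountableTopology G] [IsClosed (H : Set G)]
    (f : C_c(G, ℝ)) (x : G) :
    averageCc hH f (x : G ⧸ H) = average hH f x := rfl


omit [LocallyCompactSpace G] [MeasurableSpace ↥H] [BorelSpace ↥H] in
include hH in
/-- `h ↦ k(x h)` has compact support on `H` for `k ∈ C_c(G)`. [folklore] -/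
theorem hasCompactSupport_comp_mul [T2Space G] {k : G → ℝ} (hks : HasCompactSupport k) (x : G) :
    HasCompactSupport (fun h : ↥H => k (x * h)) := by
  have hDc : IsCompact {h : ↥H | (h : G) ∈ ({x} : Set G)⁻¹ * tsupport k} :=
    isCompact_window hH isCompact_singleton hks
  refine HasCompactSupport.intro' hDc ?_ ?_
  · exact ((isCompact_singleton (x := x)).inv.mul hks).isClosed.preimage continuous_subtype_val
  · intro h hh
    exact apply_mul_eq_zero_of_not_mem_window (subset_refl _) (mem_singleton x) hh

/-- The average of a continuous non-negative compactly supported `u` with `u(x) ≠ 0` is positive at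
`x` (Haar measures charge open sets). [folklore] -/
theorem average_pos [T2Space G] {u : G → ℝ} (hu : Continuous u) (hus : HasCompactSupport u)
    (hu0 : 0 ≤ u) {x : G} (hx : u x ≠ 0) : 0 < average hH u x := by
  haveI : LocallyCompactSpace ↥H := hH.locallyCompactSpace
  unfold average
  refine Continuous.integral_pos_of_hasCompactSupport_nonneg_nonzero (x := (1 : ↥H))
    (hu.comp (continuous_const.mul continuous_subtype_val)) (hasCompactSupport_comp_mul hH hus x)
    (fun h => hu0 _) ?_
  simpa using hx

/-! ### Lifting: `C_c(G) → C_c(G ⧸ H)` is onto, with control of the sign -/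

section Lift

variable [T2Space G] [SecondCountableTopology G] [IsClosed (H : Set G)]

omit [TopologicalSpace G] [IsTopologicalGroup G] [T2Space G] [LocallyCompactSpace G]
  [SecondCountableTopology G] [IsClosed (H : Set G)] in
/-- A point `x` lies in `x • s` whenever `1 ∈ s`. [folklore] -/
theorem mem_smul_set_self {s : Set G} (hs : (1 : G) ∈ s) (x : G) : x ∈ x • s :=
  ⟨1, hs, by simp⟩

omit [MeasurableSpace ↥H] [BorelSpace ↥H] [T2Space G] [SecondCountableTopology G]
  [IsClosed (H : Set G)] in
/-- **Compact subsets of `G ⧸ H` lift**: every compact `K ⊆ G ⧸ H` is contained in the image of a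
compact subset of `G` (finitely many translates `x • V` of a compact neighbourhood of `1`, the
images of the `x • interior V` being open since `mk` is an open map). [folklore] -/
theorem exists_isCompact_image_mk_superset {K : Set (G ⧸ H)} (hK : IsCompact K) :
    ∃ A : Set G, IsCompact A ∧ K ⊆ QuotientGroup.mk '' A := by
  obtain ⟨V, hVc, hV1⟩ := exists_compact_mem_nhds (1 : G)
  have h1 : (1 : G) ∈ interior V := mem_interior_iff_mem_nhds.2 hV1
  have hcover : K ⊆ ⋃ x : G, QuotientGroup.mk '' (x • interior V) := by
    intro q _
    induction q using QuotientGroup.induction_on with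
    | H x => exact mem_iUnion.2 ⟨x, x, mem_smul_set_self h1 x, rfl⟩
  have hopen : ∀ x : G, IsOpen (QuotientGroup.mk '' (x • interior V) : Set (G ⧸ H)) :=
    fun x => QuotientGroup.isOpenMap_coe _ (isOpen_interior.smul x)
  obtain ⟨t, ht⟩ := hK.elim_finite_subcover _ hopen hcover
  refine ⟨⋃ x ∈ t, x • V, t.isCompact_biUnion fun x _ => hVc.smul x, fun q hq => ?_⟩
  obtain ⟨x, hxt, y, hy, rfl⟩ : ∃ x ∈ t, q ∈ QuotientGroup.mk '' (x • interior V) := by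
    simpa only [mem_iUnion, exists_prop] using ht hq
  exact ⟨y, mem_iUnion₂.2 ⟨x, hxt, smul_set_mono interior_subset hy⟩, rfl⟩

/-- **Lifting lemma** (Loomis 1953, §33B): every `Φ ∈ C_c(G ⧸ H)` is the average `f♭` of some
`f ∈ C_c(G)`, which can be taken non-negative when `Φ` is.  With `A` compact, `mk(A) ⊇ tsupport Φ`,
`u ∈ C_c(G)`, `u = 1` on `A`, `0 ≤ u`, `U = u♭` (`> 0` on `A H`, `≥ c > 0` on the preimage of
`tsupport Φ`): `f = (Φ ∘ mk) · u / max(U, c)`. [folklore] -/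
theorem exists_lift (Φ : C_c(G ⧸ H, ℝ)) :
    ∃ f : C_c(G, ℝ), averageCc hH f = Φ ∧ ((∀ q, 0 ≤ Φ q) → ∀ x, 0 ≤ f x) := by
  rcases (tsupport (Φ : G ⧸ H → ℝ)).eq_empty_or_nonempty with hK0 | hKne
  · -- `Φ = 0`
    have hΦ : (Φ : G ⧸ H → ℝ) = 0 := by
      funext q
      by_contra hq
      have : q ∈ tsupport (Φ : G ⧸ H → ℝ) := subset_tsupport _ hq
      rw [hK0] at this
      exact this
    refine ⟨0, ?_, fun _ _ => le_rfl⟩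
    ext q
    induction q using QuotientGroup.induction_on with
    | H x =>
      rw [averageCc_mk]
      show average hH (fun _ => (0 : ℝ)) x = Φ x
      rw [show (Φ : G ⧸ H → ℝ) x = 0 from congrFun hΦ _]
      unfold average
      simp
  -- the compact `A ⊆ G` with `mk(A) ⊇ tsupport Φ`, and `u`
  obtain ⟨A, hAc, hKA⟩ := exists_isCompact_image_mk_superset Φ.hasCompactSupport
  obtain ⟨u, huA, -, hus, hu01⟩ := exists_continuous_one_zero_of_isCompact hAc isClosed_empty
    (disjoint_empty A)
  have hu0 : ∀ x, 0 ≤ u x := fun x => (hu01 x).1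
  set U : G → ℝ := average hH u with hU
  have hUc : Continuous U := continuous_average hH u.continuous hus
  have hUinv : ∀ (x : G) (h : ↥H), U (x * h) = U x := fun x h => average_mul_coe hH u x h
  have hUpos : ∀ x ∈ A, 0 < U x := fun x hx =>
    average_pos hH u.continuous hus hu0 (by rw [huA hx]; exact one_ne_zero)
  -- positive lower bound of `U` over the preimage of `tsupport Φ`
  have hUquot : Continuous (averageQuot hH u) := continuous_averageQuot hH u.continuous hus
  obtain ⟨q₀, hq₀K, hq₀min⟩ :=
    Φ.hasCompactSupport.exists_isMinOn hKne hUquot.continuousOn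
  obtain ⟨x₀, hx₀A, hx₀q⟩ := hKA hq₀K
  set c : ℝ := U x₀ with hc
  have hcpos : 0 < c := hUpos x₀ hx₀A
  have hcle : ∀ x : G, (x : G ⧸ H) ∈ tsupport (Φ : G ⧸ H → ℝ) → c ≤ U x := by
    intro x hx
    have := hq₀min hx
    rw [mem_setOf_eq, ← hx₀q] at this
    exact this
  -- the lift
  set F : G → ℝ := fun x => Φ (x : G ⧸ H) / max (U x) c * u x with hF
  have hmax : ∀ x, 0 < max (U x) c := fun x => lt_max_of_lt_right hcpos
  have hFc : Continuous F := by
    refine Continuous.mul (Continuous.div (Φ.continuous.comp QuotientGroup.continuous_mk)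
      (hUc.max continuous_const) fun x => (hmax x).ne') u.continuous
  have hFs : HasCompactSupport F := hus.mul_left
  refine ⟨⟨⟨F, hFc⟩, hFs⟩, ?_, ?_⟩
  · ext q
    induction q using QuotientGroup.induction_on with
    | H x =>
      rw [averageCc_mk]
      show average hH F x = Φ x
      have hinv : ∀ (y : G) (h : ↥H), Φ ((y * h : G) : G ⧸ H) / max (U (y * h)) c =
          Φ (y : G ⧸ H) / max (U y) c := by
        intro y h
        rw [hUinv]
        congr 2
        rw [QuotientGroup.eq]
        simp
      rw [hF, average_mul_of_invariant hH u (fun y => Φ (y : G ⧸ H) / max (U y) c) hinv x]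
      by_cases hΦx : Φ (x : G ⧸ H) = 0
      · rw [hΦx, zero_div, zero_mul]
      · have hxK : (x : G ⧸ H) ∈ tsupport (Φ : G ⧸ H → ℝ) := subset_tsupport _ hΦx
        have hUx : max (U x) c = U x := max_eq_left (hcle x hxK)
        rw [hUx]
        change Φ (x : G ⧸ H) / U x * U x = Φ (x : G ⧸ H)
        rw [div_mul_cancel₀ _ ((hcpos.trans_le (hcle x hxK)).ne')]
  · intro hΦ x
    change 0 ≤ Φ (x : G ⧸ H) / max (U x) c * u x
    exact mul_nonneg (div_nonneg (hΦ _) (hmax x).le) (hu0 x)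

end Lift

end WeilQuotient

end Literature.MeasureTheory.Group

end
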